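import Summits.BirchSwinnertonDyer.BirchSwinnertonDyer.Theorems.ShaPrimaryTransferFiniteShaComponentTransferSelmerCubicCoverCl
import Summits.BirchSwinnertonDyer.BirchSwinnertonDyer.Theorems.Rank2ObservatoryRank3Witness
import Literature.NumberTheory.EllipticCurves.KubertTateSevenRational
import HarnessLib

/-!
# BirchSwinnertonDyer — SEL2CUBIC doors: transport of `t₂ = 0` along the row models (generic plumbing)

HONEST FRAMING: route `ShaPrimaryTransfer`, seat `bsd-line-spt-p1` (g30), `--supports` item T =
`FiniteShaComponentTransfer` (stmt-22356), UNCHANGED (conjecture-grade at corank ≥ 2). BSD in rank ≥ 2 is NOT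
proved by any of this. THEOREMS ONLY.

The census rows of the kernel `2`-descent certify a model `(0, A, 0, B, C)` that is the completed square of the
curve's model `(a₁, a₂, a₃, a₄, a₆)`, possibly RESCALED by `d` (`A = d²(a₁² + 4a₂)`, `B = 8d⁴(a₁a₃ + 2a₄)`,
`C = 16d⁶(a₃² + 4a₆)`), or is the curve itself (`a₁ = a₃ = 0`). The SEL2CUBIC door theorems conclude
`t₂ = 0 ∧ Ш[2^∞] = 0 ∧ rank = r` for the certified model; this file carries the conclusion `t₂ = 0 ∧ rank = r`
back to the original model ONCE for every checker variant (`t_p` and the rank are invariant under an admissible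
change of variables: `shaCorank_eq_zero_iff_of_smul_eq`, `mordellWeilRank_eq_of_smul_eq`), and records the
non-strict closing step `#Sel⁽²⁾(E/ℚ) ≤ 2^r ∧ rank ≥ r ⟹ door` used by the `≤ 2^r` checkers
(`checkE2`, `checkS`, `checkE2R`, `checkRS`, …).
[cite: SilvermanAEC2009, III.3.1(b), Thm. X.4.2, Rem. X.4.1] [cite: CremonaAlgorithms1997, §3.6]
-/

-- single-conjunct summit: `Summit.BirchSwinnertonDyer.BirchSwinnertonDyer.…` repeats the name by design
set_option linter.dupNamespace false

noncomputable section

open scoped Classical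

open Literature.NumberTheory.EllipticCurves WeierstrassCurve

namespace Summit.BirchSwinnertonDyer.BirchSwinnertonDyer.Theorems.ShaPrimaryTransferSelmerCubicCover

open Summit.BirchSwinnertonDyer.BirchSwinnertonDyer.Rank2Observatory
open Summit.BirchSwinnertonDyer.BirchSwinnertonDyer.Rank2Observatory.TwoDescCubic

/-- **Closing step of a complete `2`-descent, non-strict form**: `#Sel⁽²⁾(E/K) ≤ 2^r` together with
`rank E(K) ≥ r` gives `t₂(E) = 0`, `Ш(E/K)[2^∞] = 0` and `rank E(K) = r` (the tree's
`shaCorank_eq_zero_of_natCard_selmerGroup_le` at `p = 2`). [cite: SilvermanAEC2009, Thm. X.4.2, Rem. X.4.1] -/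
theorem sha_door_of_natCard_selmerGroup_two_le {K : Type} [Field K] [NumberField K] (E : WeierstrassCurve K)
    [E.IsElliptic] {r : ℕ} (hle : Nat.card (selmerGroup E 2) ≤ 2 ^ r) (hr : r ≤ E.mordellWeilRank) :
    E.shaCorank 2 = 0 ∧ AddCommGroup.primaryComponent E.sha 2 = ⊥ ∧ E.mordellWeilRank = r :=
  E.shaCorank_eq_zero_of_natCard_selmerGroup_le 2 hle hr

/-- The integral short model read over `ℚ` is the rational short model. [folklore] -/
theorem map_shortModel (A B C : ℤ) :
    ((⟨0, A, 0, B, C⟩ : WeierstrassCurve ℤ)).map (Int.castRingHom ℚ) = (⟨0, A, 0, B, C⟩ : WeierstrassCurve ℚ) := by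
  ext <;> simp [WeierstrassCurve.map]

/-- **Transport of the door to the integral short model**: a door proved for the rational model `(0, A, 0, B, C)`
under `r ≤ rank` gives the door for `(⟨0, A, 0, B, C⟩ : WeierstrassCurve ℤ)` read over `ℚ`. [folklore] -/
theorem sha_door_map_of_door {A B C : ℤ} {r : ℕ}
    (hdoor : r ≤ ((⟨0, A, 0, B, C⟩ : WeierstrassCurve ℚ)).mordellWeilRank →
      ((⟨0, A, 0, B, C⟩ : WeierstrassCurve ℚ)).shaCorank 2 = 0 ∧
        AddCommGroup.primaryComponent ((⟨0, A, 0, B, C⟩ : WeierstrassCurve ℚ)).sha 2 = ⊥ ∧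
          ((⟨0, A, 0, B, C⟩ : WeierstrassCurve ℚ)).mordellWeilRank = r)
    (hlow : r ≤ (((⟨0, A, 0, B, C⟩ : WeierstrassCurve ℤ)).map (Int.castRingHom ℚ)).mordellWeilRank) :
    (((⟨0, A, 0, B, C⟩ : WeierstrassCurve ℤ)).map (Int.castRingHom ℚ)).shaCorank 2 = 0 ∧
      AddCommGroup.primaryComponent (((⟨0, A, 0, B, C⟩ : WeierstrassCurve ℤ)).map (Int.castRingHom ℚ)).sha 2
          = ⊥ ∧
        (((⟨0, A, 0, B, C⟩ : WeierstrassCurve ℤ)).map (Int.castRingHom ℚ)).mordellWeilRank = r := by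
  rw [map_shortModel] at hlow ⊢
  exact hdoor hlow

/-- **Transport of `t₂ = 0 ∧ rank = r` along completing-the-square and rescaling.** If the records certify
the model `(0, A, 0, B, C)` with `A = d²(a₁² + 4a₂)`, `B = 8d⁴(a₁a₃ + 2a₄)`, `C = 16d⁶(a₃² + 4a₆)` (`d ≠ 0`,
`Δ ≠ 0`), and the door holds for that model whenever `r ≤` its rank, then `t₂ = 0` and `rank = r` for the
ORIGINAL model `(a₁, a₂, a₃, a₄, a₆)` as soon as `r ≤` its rank: the two models differ by the admissible change
of variables `(x, y) ↦ (4d²x − …, 8d³y − …)`, under which `t_p` and the rank are invariant.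
[cite: SilvermanAEC2009, III.3.1(b), X.§4 Rem. 4.1.1] [cite: CremonaAlgorithms1997, §3.6] -/
theorem shaCorank_two_transport_scaled {A B C : ℤ} (a₁ a₂ a₃ a₄ a₆ d : ℤ) (hd : d ≠ 0)
    (hABC : A = d ^ 2 * (a₁ ^ 2 + 4 * a₂) ∧ B = d ^ 4 * (8 * (a₁ * a₃ + 2 * a₄)) ∧
      C = d ^ 6 * (16 * (a₃ ^ 2 + 4 * a₆)))
    (hΔ : deltaShort A B C ≠ 0) {r : ℕ}
    (hdoor : r ≤ ((⟨0, A, 0, B, C⟩ : WeierstrassCurve ℚ)).mordellWeilRank →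
      ((⟨0, A, 0, B, C⟩ : WeierstrassCurve ℚ)).shaCorank 2 = 0 ∧
        AddCommGroup.primaryComponent ((⟨0, A, 0, B, C⟩ : WeierstrassCurve ℚ)).sha 2 = ⊥ ∧
          ((⟨0, A, 0, B, C⟩ : WeierstrassCurve ℚ)).mordellWeilRank = r)
    (hlow : r ≤ (((⟨a₁, a₂, a₃, a₄, a₆⟩ : WeierstrassCurve ℤ)).map (Int.castRingHom ℚ)).mordellWeilRank) :
    (((⟨a₁, a₂, a₃, a₄, a₆⟩ : WeierstrassCurve ℤ)).map (Int.castRingHom ℚ)).shaCorank 2 = 0 ∧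
      (((⟨a₁, a₂, a₃, a₄, a₆⟩ : WeierstrassCurve ℤ)).map (Int.castRingHom ℚ)).mordellWeilRank = r := by
  obtain ⟨hA, hB, hC⟩ := hABC
  -- the combined change of variables `orig ↦ (0, A, 0, B, C)` over `ℚ`
  set W₀ := ((⟨a₁, a₂, a₃, a₄, a₆⟩ : WeierstrassCurve ℤ)).map (Int.castRingHom ℚ) with hW₀
  have hd' : (d : ℚ) ≠ 0 := by exact_mod_cast hd
  set V : WeierstrassCurve.VariableChange ℚ :=
    ⟨Units.mk0 (1 / (2 * d) : ℚ) (by simp [hd']), 0, -(a₁ : ℚ) / 2, -(a₃ : ℚ) / 2⟩ with hVdef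
  have hV : V • W₀ = (⟨0, A, 0, B, C⟩ : WeierstrassCurve ℚ) := by
    ext <;> simp only [hW₀, hVdef, WeierstrassCurve.map_a₁, WeierstrassCurve.map_a₂, WeierstrassCurve.map_a₃,
      WeierstrassCurve.map_a₄, WeierstrassCurve.map_a₆, WeierstrassCurve.variableChange_a₁,
      WeierstrassCurve.variableChange_a₂, WeierstrassCurve.variableChange_a₃,
      WeierstrassCurve.variableChange_a₄, WeierstrassCurve.variableChange_a₆, Units.val_inv_eq_inv_val,
      Units.val_mk0, hA, hB, hC, eq_intCast, Int.cast_add, Int.cast_mul, Int.cast_pow, Int.cast_ofNat,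
      one_div] <;> field_simp <;> ring
  have hr : W₀.mordellWeilRank = ((⟨0, A, 0, B, C⟩ : WeierstrassCurve ℚ)).mordellWeilRank :=
    mordellWeilRank_eq_of_smul_eq _ _ _ hV
  rw [hr] at hlow
  obtain ⟨h0, -, hrank⟩ := hdoor hlow
  refine ⟨?_, by rw [hr, hrank]⟩
  haveI h2 : ((⟨0, A, 0, B, C⟩ : WeierstrassCurve ℚ)).IsElliptic := isElliptic_of_deltaShort_ne hΔ
  haveI h1 : W₀.IsElliptic := by
    rw [← inv_smul_smul V W₀, hV]
    infer_instance
  exact (shaCorank_eq_zero_iff_of_smul_eq _ _ _ hV 2).mpr h0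

/-- The plain completed-square case (`d = 1`) of `shaCorank_two_transport_scaled`.
[cite: SilvermanAEC2009, III.3.1(b)] [cite: CremonaAlgorithms1997, §3.6] -/
theorem shaCorank_two_transport_complSq {A B C : ℤ} (a₁ a₂ a₃ a₄ a₆ : ℤ)
    (hABC : A = a₁ ^ 2 + 4 * a₂ ∧ B = 8 * (a₁ * a₃ + 2 * a₄) ∧ C = 16 * (a₃ ^ 2 + 4 * a₆))
    (hΔ : deltaShort A B C ≠ 0) {r : ℕ}
    (hdoor : r ≤ ((⟨0, A, 0, B, C⟩ : WeierstrassCurve ℚ)).mordellWeilRank →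
      ((⟨0, A, 0, B, C⟩ : WeierstrassCurve ℚ)).shaCorank 2 = 0 ∧
        AddCommGroup.primaryComponent ((⟨0, A, 0, B, C⟩ : WeierstrassCurve ℚ)).sha 2 = ⊥ ∧
          ((⟨0, A, 0, B, C⟩ : WeierstrassCurve ℚ)).mordellWeilRank = r)
    (hlow : r ≤ (((⟨a₁, a₂, a₃, a₄, a₆⟩ : WeierstrassCurve ℤ)).map (Int.castRingHom ℚ)).mordellWeilRank) :
    (((⟨a₁, a₂, a₃, a₄, a₆⟩ : WeierstrassCurve ℤ)).map (Int.castRingHom ℚ)).shaCorank 2 = 0 ∧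
      (((⟨a₁, a₂, a₃, a₄, a₆⟩ : WeierstrassCurve ℤ)).map (Int.castRingHom ℚ)).mordellWeilRank = r :=
  shaCorank_two_transport_scaled a₁ a₂ a₃ a₄ a₆ 1 one_ne_zero
    (by obtain ⟨hA, hB, hC⟩ := hABC; exact ⟨by rw [hA]; ring, by rw [hB]; ring, by rw [hC]; ring⟩) hΔ hdoor hlow

/-- The plain-model case (`a₁ = a₃ = 0`, the record's cubic IS the curve): the full door for
`(⟨0, a₂, 0, a₄, a₆⟩ : WeierstrassCurve ℤ)` read over `ℚ`. [cite: CremonaAlgorithms1997, §3.6] -/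
theorem sha_door_transport_plain {A B C : ℤ} (a₂ a₄ a₆ : ℤ) (hABC : A = a₂ ∧ B = a₄ ∧ C = a₆) {r : ℕ}
    (hdoor : r ≤ ((⟨0, A, 0, B, C⟩ : WeierstrassCurve ℚ)).mordellWeilRank →
      ((⟨0, A, 0, B, C⟩ : WeierstrassCurve ℚ)).shaCorank 2 = 0 ∧
        AddCommGroup.primaryComponent ((⟨0, A, 0, B, C⟩ : WeierstrassCurve ℚ)).sha 2 = ⊥ ∧
          ((⟨0, A, 0, B, C⟩ : WeierstrassCurve ℚ)).mordellWeilRank = r)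
    (hlow : r ≤ (((⟨0, a₂, 0, a₄, a₆⟩ : WeierstrassCurve ℤ)).map (Int.castRingHom ℚ)).mordellWeilRank) :
    (((⟨0, a₂, 0, a₄, a₆⟩ : WeierstrassCurve ℤ)).map (Int.castRingHom ℚ)).shaCorank 2 = 0 ∧
      AddCommGroup.primaryComponent (((⟨0, a₂, 0, a₄, a₆⟩ : WeierstrassCurve ℤ)).map (Int.castRingHom ℚ)).sha 2
          = ⊥ ∧
        (((⟨0, a₂, 0, a₄, a₆⟩ : WeierstrassCurve ℤ)).map (Int.castRingHom ℚ)).mordellWeilRank = r := by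
  obtain ⟨rfl, rfl, rfl⟩ := hABC
  exact sha_door_map_of_door hdoor hlow

end Summit.BirchSwinnertonDyer.BirchSwinnertonDyer.Theorems.ShaPrimaryTransferSelmerCubicCover

end
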